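import Mathlib.Analysis.Complex.Hadamard
import Mathlib.Analysis.Complex.Liouville
import Mathlib.Analysis.SpecialFunctions.Trigonometric.Deriv
import Mathlib.Analysis.SpecialFunctions.Trigonometric.DerivHyp
import Mathlib.Analysis.SpecialFunctions.Pow.Real
import Literature.Analysis.SpecialFunctions.GammaVerticalBounds

/-!
# N19 (NE7, s3 ALTERNATIVE CURRENCY) — Three lines around a short segment: the derivative at the centre of an entire function of
# exponential type that is small on `[−l₀, l₀]`

Module 104 of the `dag-n19-e` lineage (CURRENCY-MAP v4 open item «the log-log gap of the EXPECTATION currency», open since g10).  The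
complex-analysis half.  Module p480837 (`…N19ExpectationCurrencyTwoConstants`) bounded `‖f′(0)‖` for `f` holomorphic on the disc `|z| ≤ l₀`,
`≤ M` there and `≤ m` on the real DIAMETER, by `2e·m·(1 + log(M∕m))∕l₀` (two constants disc ∕ diameter) — and noted that within THAT class the
logarithm is not removable.  The difference of two moment generating functions of laws on `[−B,B]` is, however, ENTIRE OF EXPONENTIAL TYPE:
`‖f(z)‖ ≤ A·e^{b‖z‖}` on all of `ℂ`.  For that smaller class the far field helps: seen from a LARGE region, the short segment `[−l₀,l₀]` has small
harmonic measure, and the price of the derivative improves by the factor `1∕log(size of the region ∕ l₀)`.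

THE DEVICE (no harmonic measure needed): the entire map `w ↦ l₀·cos w` sends the real axis ONTO the segment `[−l₀,l₀]` and the horizontal
strip `|Im w| ≤ Y` into the disc `‖z‖ ≤ l₀·cosh Y` (`‖cos w‖ ≤ cosh(Im w)`, the tree's `Literature.Analysis.SpecialFunctions.GammaVert.norm_cos_le_cosh_im`, §1); so `G = f ∘ (l₀cos)` is `≤ m` on the real axis and
`≤ M_Y = A·e^{b·l₀·cosh Y}` on the strip, and Mathlib's HADAMARD THREE-LINES THEOREM gives `‖G(w)‖ ≤ m^{1−|Im w|∕Y}·M_Y^{|Im w|∕Y}` (§2);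
Cauchy's estimate on the circle `|w − π∕2| = y` and the chain rule `G′(π∕2) = −l₀·f′(0)` (`cos(π∕2) = 0`, `sin(π∕2) = 1`) give ★
`norm_deriv_le_segment_threeLines`: `‖f′(0)‖ ≤ m^{1−y∕Y}·M_Y^{y∕Y}∕(l₀·y)` for every `0 < y ≤ Y`, and the choice `y = Y∕log(M_Y∕m)` gives ★★
`norm_deriv_le_segment_far`: `‖f′(0)‖ ≤ e·m·log(M_Y∕m)∕(l₀·Y)`.  With `e^Y ≍ L∕(b·l₀)` this is `≍ m·L∕(l₀·log(L∕(bl₀)))`, `L = log(A∕m)` — the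
`log log` that module p480837 could not see (module 105 cashes it for the expectation currency).

HONEST FRAMING: [folklore] complex analysis (Hadamard three lines ∕ Nevanlinna two constants, e.g. [Ransford1995] §4.3) over Mathlib
(`Complex.HadamardThreeLines.norm_le_interp_of_mem_verticalClosedStrip₀₁'`, `Complex.norm_deriv_le_of_forall_mem_sphere_norm_le`); values in a
complex Banach space; no probability, no scheme object, no consumer in the DAG today; nothing of Bałaban's is instantiated; NE7 is NOT PRINTED and
NOT proved here; N19 is NOT discharged; count-neutral.  One finite 𝕋⁴ programme at fixed ε; nothing continuum ∕ OS ∕ mass-gap ∕ Clay.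
0 `def` ∕ 0 `sorry`.
-/

noncomputable section

open Set Metric Filter Topology Complex Real

namespace Summit.QuantumFields.YangMills.Theorems.BalabanUVNodesN19SegmentThreeLines

open Complex.HadamardThreeLines (verticalStrip verticalClosedStrip norm_le_interp_of_mem_verticalClosedStrip₀₁')
open Literature.Analysis.SpecialFunctions.GammaVert (norm_cos_le_cosh_im)

variable {E : Type*} [NormedAddCommGroup E] [NormedSpace ℂ E]

/-! ## §1 The cosine map: real axis ↦ the segment, strip ↦ the disc [folklore] -/

/-- On the strip `|Im w| ≤ Y`: `‖l₀·cos w‖ ≤ l₀·cosh Y` (`l₀ ≥ 0`). [folklore] -/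
theorem norm_mul_cos_le {l₀ Y : ℝ} (hl₀ : 0 ≤ l₀) {w : ℂ} (hw : |w.im| ≤ Y) :
    ‖(l₀ : ℂ) * Complex.cos w‖ ≤ l₀ * Real.cosh Y := by
  rw [norm_mul, Complex.norm_real, Real.norm_eq_abs, abs_of_nonneg hl₀]
  refine mul_le_mul_of_nonneg_left ((norm_cos_le_cosh_im w).trans ?_) hl₀
  rw [Real.cosh_le_cosh]
  exact hw.trans (le_abs_self Y)

/-- On the real axis the cosine map lands in the segment: `l₀·cos u = ↑(l₀ cos u)` with `|l₀ cos u| ≤ l₀`. [bookkeeping] -/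
theorem mul_cos_ofReal {l₀ : ℝ} (hl₀ : 0 ≤ l₀) (u : ℝ) :
    (l₀ : ℂ) * Complex.cos (u : ℂ) = ((l₀ * Real.cos u : ℝ) : ℂ) ∧ |l₀ * Real.cos u| ≤ l₀ := by
  refine ⟨by rw [← Complex.ofReal_cos]; push_cast; ring, ?_⟩
  rw [abs_mul, abs_of_nonneg hl₀]
  exact mul_le_of_le_one_right hl₀ (Real.abs_cos_le_one u)

/-! ## §2 Three lines on the horizontal strip for `G = f ∘ (l₀cos)` [folklore] -/

/-- THREE LINES, UPPER HALF-STRIP: `G` entire, `‖G‖ ≤ M` on `0 ≤ Im w ≤ Y`, `‖G(u)‖ ≤ m` for real `u`; then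
`‖G(w)‖ ≤ m^{1−Im w∕Y}·M^{Im w∕Y}` for `0 ≤ Im w ≤ Y` (Mathlib's vertical three-lines theorem for `s ↦ G(iYs)`). [folklore] -/
theorem norm_le_interp_of_im_mem {G : ℂ → E} (hG : Differentiable ℂ G) {Y m M : ℝ} (hY : 0 < Y)
    (hM : ∀ w : ℂ, 0 ≤ w.im → w.im ≤ Y → ‖G w‖ ≤ M) (hm : ∀ u : ℝ, ‖G u‖ ≤ m)
    {w : ℂ} (hw0 : 0 ≤ w.im) (hwY : w.im ≤ Y) :
    ‖G w‖ ≤ m ^ (1 - w.im / Y) * M ^ (w.im / Y) := by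
  -- `F s = G(i·Y·s)`: `Re s = 0 ↦` the real axis, `Re s = σ ↦ Im = Yσ`
  set F : ℂ → E := fun s => G (I * Y * s) with hF
  have him : ∀ s : ℂ, (I * Y * s).im = Y * s.re := fun s => by simp
  have hFd : DiffContOnCl ℂ F (verticalStrip 0 1) :=
    (hG.comp ((differentiable_id.const_mul (I * Y)))).diffContOnCl
  have hFM : ∀ s ∈ verticalClosedStrip 0 1, ‖F s‖ ≤ M := fun s hs => by
    simp only [verticalClosedStrip, mem_preimage, mem_Icc] at hs
    refine hM _ ?_ ?_ <;> rw [him] <;> nlinarith [hs.1, hs.2]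
  have hB : BddAbove ((norm ∘ F) '' verticalClosedStrip 0 1) :=
    ⟨M, by rintro _ ⟨s, hs, rfl⟩; exact hFM s hs⟩
  have ha : ∀ s ∈ re ⁻¹' ({0} : Set ℝ), ‖F s‖ ≤ m := fun s hs => by
    simp only [mem_preimage, mem_singleton_iff] at hs
    have e : I * Y * s = ((-(Y * s.im) : ℝ) : ℂ) := by
      apply Complex.ext <;> simp [hs]
    show ‖G (I * Y * s)‖ ≤ m
    rw [e]; exact hm _
  have hb : ∀ s ∈ re ⁻¹' ({1} : Set ℝ), ‖F s‖ ≤ M := fun s hs => by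
    simp only [mem_preimage, mem_singleton_iff] at hs
    refine hM _ ?_ ?_ <;> rw [him, hs] <;> linarith
  -- the point `s = w∕(iY)` has `Re s = Im w ∕ Y ∈ [0,1]`
  set s : ℂ := -I * w / Y with hs
  have hYne : (Y : ℂ) ≠ 0 := Complex.ofReal_ne_zero.2 hY.ne'
  have hsw : I * Y * s = w := by
    rw [hs]; field_simp; ring_nf; rw [Complex.I_sq]; ring
  have hsre : s.re = w.im / Y := by
    rw [hs]; simp [Complex.div_re, Complex.normSq_apply]; field_simp
  have hsmem : s ∈ verticalClosedStrip 0 1 := by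
    simp only [verticalClosedStrip, mem_preimage, mem_Icc, hsre]
    exact ⟨div_nonneg hw0 hY.le, (div_le_one hY).2 hwY⟩
  have key := norm_le_interp_of_mem_verticalClosedStrip₀₁' F hsmem hFd hB ha hb
  rw [hsre] at key
  simpa only [hF, hsw] using key

/-- THREE LINES ON THE FULL STRIP `|Im w| ≤ Y`: `‖G(w)‖ ≤ m^{1−|Im w|∕Y}·M^{|Im w|∕Y}` (the lower half by `w ↦ G(−w)`). [folklore] -/
theorem norm_le_interp_of_abs_im_le {G : ℂ → E} (hG : Differentiable ℂ G) {Y m M : ℝ} (hY : 0 < Y)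
    (hM : ∀ w : ℂ, |w.im| ≤ Y → ‖G w‖ ≤ M) (hm : ∀ u : ℝ, ‖G u‖ ≤ m) {w : ℂ} (hw : |w.im| ≤ Y) :
    ‖G w‖ ≤ m ^ (1 - |w.im| / Y) * M ^ (|w.im| / Y) := by
  rcases le_or_gt 0 w.im with h0 | h0
  · rw [abs_of_nonneg h0] at hw ⊢
    exact norm_le_interp_of_im_mem hG hY (fun v hv0 hvY => hM v (by rwa [abs_of_nonneg hv0])) hm h0 hw
  · -- reflect: `G⁻(v) = G(−v)` on the upper half-strip
    have h := norm_le_interp_of_im_mem (G := fun v => G (-v)) (hG.comp differentiable_neg) hY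
      (fun v hv0 hvY => hM (-v) (by rw [Complex.neg_im, abs_neg, abs_of_nonneg hv0]; exact hvY))
      (fun u => by have := hm (-u); push_cast at this ⊢; exact this) (w := -w)
      (by rw [Complex.neg_im]; linarith) (by rw [Complex.neg_im, ← abs_of_neg h0]; exact hw)
    rw [neg_neg, Complex.neg_im, ← abs_of_neg h0] at h
    exact h

/-! ## §3 The derivative at the centre of the segment [folklore] -/

/-- The chain rule at `w = π∕2`: `(f ∘ (l₀cos))′(π∕2) = −l₀·f′(0)`, so `‖f′(0)‖·l₀ = ‖(f ∘ (l₀cos))′(π∕2)‖`. [bookkeeping] -/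
theorem norm_deriv_comp_mul_cos {f : ℂ → E} (hf : Differentiable ℂ f) (l₀ : ℝ) :
    ‖deriv (fun w : ℂ => f ((l₀ : ℂ) * Complex.cos w)) (π / 2 : ℂ)‖ = |l₀| * ‖deriv f 0‖ := by
  have hcos : HasDerivAt (fun w : ℂ => (l₀ : ℂ) * Complex.cos w) ((l₀ : ℂ) * -Complex.sin (π / 2 : ℂ)) (π / 2 : ℂ) :=
    (Complex.hasDerivAt_cos _).const_mul _
  have h0 : (l₀ : ℂ) * Complex.cos (π / 2 : ℂ) = 0 := by
    rw [show (π / 2 : ℂ) = ((π / 2 : ℝ) : ℂ) by push_cast; ring, ← Complex.ofReal_cos, Real.cos_pi_div_two]; simp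
  have hfd : HasDerivAt f (deriv f 0) ((l₀ : ℂ) * Complex.cos (π / 2 : ℂ)) := by
    rw [h0]; exact (hf 0).hasDerivAt
  have hcomp : HasDerivAt (fun w : ℂ => f ((l₀ : ℂ) * Complex.cos w))
      (((l₀ : ℂ) * -Complex.sin (π / 2 : ℂ)) • deriv f 0) (π / 2 : ℂ) := hfd.scomp (π / 2 : ℂ) hcos
  rw [hcomp.deriv]
  have hsin : Complex.sin (π / 2 : ℂ) = 1 := by
    rw [show (π / 2 : ℂ) = ((π / 2 : ℝ) : ℂ) by push_cast; ring, ← Complex.ofReal_sin, Real.sin_pi_div_two]; simp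
  rw [hsin, mul_neg, mul_one, neg_smul, norm_neg, norm_smul, Complex.norm_real, Real.norm_eq_abs]

omit [NormedSpace ℂ E] in
/-- `‖f(0)‖ ≤ A` forces `A ≥ 0`. [bookkeeping] -/
theorem nonneg_of_growth {f : ℂ → E} {A b : ℝ} (hgrowth : ∀ z : ℂ, ‖f z‖ ≤ A * Real.exp (b * ‖z‖)) : 0 ≤ A := by
  have h := hgrowth 0
  have hE : 0 < Real.exp (b * ‖(0 : ℂ)‖) := Real.exp_pos _
  by_contra hA
  push Not at hA
  have : A * Real.exp (b * ‖(0 : ℂ)‖) < 0 := mul_neg_of_neg_of_pos hA hE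
  linarith [norm_nonneg (f 0)]

/-- ★ **THE DERIVATIVE AT THE CENTRE OF A SHORT SEGMENT, master form.**  `f` entire with values in a complex Banach space,
`‖f(z)‖ ≤ A·e^{b‖z‖}` everywhere (`b ≥ 0`), `‖f(t)‖ ≤ m` for real `|t| ≤ l₀` (`0 < m`, `0 < l₀`); then for every `0 < y ≤ Y` with
`m ≤ M_Y := A·e^{b·l₀·cosh Y}`: `‖f′(0)‖ ≤ m^{1−y∕Y}·M_Y^{y∕Y}∕(l₀·y)` (three lines for `f ∘ (l₀cos)` on `|Im w| ≤ Y`, Cauchy on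
`|w − π∕2| = y`). [folklore] -/
theorem norm_deriv_le_segment_threeLines {f : ℂ → E} (hf : Differentiable ℂ f) {A b m l₀ Y y : ℝ} (hb : 0 ≤ b) (hl₀ : 0 < l₀)
    (hgrowth : ∀ z : ℂ, ‖f z‖ ≤ A * Real.exp (b * ‖z‖)) (hm : ∀ t : ℝ, |t| ≤ l₀ → ‖f t‖ ≤ m) (hm0 : 0 < m)
    (hmM : m ≤ A * Real.exp (b * (l₀ * Real.cosh Y))) (hy : 0 < y) (hyY : y ≤ Y) :
    ‖deriv f 0‖ ≤ m ^ (1 - y / Y) * (A * Real.exp (b * (l₀ * Real.cosh Y))) ^ (y / Y) / (l₀ * y) := by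
  have hY : 0 < Y := hy.trans_le hyY
  have hA : 0 ≤ A := nonneg_of_growth hgrowth
  set M : ℝ := A * Real.exp (b * (l₀ * Real.cosh Y)) with hMdef
  set G : ℂ → E := fun w => f ((l₀ : ℂ) * Complex.cos w) with hG
  have hGd : Differentiable ℂ G := hf.comp ((Complex.differentiable_cos).const_mul _)
  -- the two bounds for `G`
  have hGM : ∀ w : ℂ, |w.im| ≤ Y → ‖G w‖ ≤ M := fun w hw =>
    (hgrowth _).trans (mul_le_mul_of_nonneg_left
      (Real.exp_le_exp.2 (mul_le_mul_of_nonneg_left (norm_mul_cos_le hl₀.le hw) hb)) hA)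
  have hGm : ∀ u : ℝ, ‖G u‖ ≤ m := fun u => by
    obtain ⟨e, hle⟩ := mul_cos_ofReal hl₀.le u
    show ‖f ((l₀ : ℂ) * Complex.cos u)‖ ≤ m
    rw [e]; exact hm _ hle
  -- three lines on the circle `|w − π∕2| = y ⊆ {|Im w| ≤ y}`
  have hratio : 1 ≤ M / m := (one_le_div hm0).2 hmM
  have hmono : ∀ t : ℝ, m ^ (1 - t) * M ^ t = m * (M / m) ^ t := fun t => by
    rw [Real.div_rpow (hm0.le.trans hmM) hm0.le, Real.rpow_sub hm0, Real.rpow_one]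
    field_simp
  have hC : ∀ w ∈ sphere (π / 2 : ℂ) y, ‖G w‖ ≤ m ^ (1 - y / Y) * M ^ (y / Y) := by
    intro w hw
    have hwim : |w.im| ≤ y := by
      have h1 := Complex.abs_im_le_norm (w - (π / 2 : ℂ))
      have h2 : (w - (π / 2 : ℂ)).im = w.im := by simp
      rw [h2] at h1
      rw [mem_sphere, dist_eq_norm] at hw
      linarith
    refine (norm_le_interp_of_abs_im_le hGd hY hGM hGm (hwim.trans hyY)).trans ?_
    rw [hmono, hmono]
    exact mul_le_mul_of_nonneg_left (Real.rpow_le_rpow_of_exponent_le hratio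
      (div_le_div_of_nonneg_right hwim hY.le)) hm0.le
  have hGy : DiffContOnCl ℂ G (ball (π / 2 : ℂ) y) := hGd.diffContOnCl
  have key := Complex.norm_deriv_le_of_forall_mem_sphere_norm_le hy hGy hC
  rw [hG, norm_deriv_comp_mul_cos hf l₀, abs_of_pos hl₀] at key
  rw [le_div_iff₀ (mul_pos hl₀ hy)]
  calc ‖deriv f 0‖ * (l₀ * y) = l₀ * ‖deriv f 0‖ * y := by ring
    _ ≤ m ^ (1 - y / Y) * M ^ (y / Y) / y * y := mul_le_mul_of_nonneg_right key hy.le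
    _ = m ^ (1 - y / Y) * M ^ (y / Y) := div_mul_cancel₀ _ hy.ne'

/-- ★★ **THE DERIVATIVE AT THE CENTRE OF A SHORT SEGMENT, optimised.**  Under the hypotheses of `norm_deriv_le_segment_threeLines` with
`Λ := log(M_Y∕m) ≥ 1` (`M_Y = A·e^{b·l₀·cosh Y}`, `Y > 0`): `‖f′(0)‖ ≤ e·m·Λ∕(l₀·Y)` (the choice `y = Y∕Λ`).  For the difference of two mgfs
(`A = 2`, `b = B`, `m = 2εe^{l₀B}`) and `e^Y ≍ L∕(Bl₀)`: `≍ ε·L∕(l₀·log(L∕(Bl₀)))` — module 105. [folklore] -/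
theorem norm_deriv_le_segment_far {f : ℂ → E} (hf : Differentiable ℂ f) {A b m l₀ Y : ℝ} (hb : 0 ≤ b) (hl₀ : 0 < l₀)
    (hgrowth : ∀ z : ℂ, ‖f z‖ ≤ A * Real.exp (b * ‖z‖)) (hm : ∀ t : ℝ, |t| ≤ l₀ → ‖f t‖ ≤ m) (hm0 : 0 < m) (hY : 0 < Y)
    (hΛ : 1 ≤ Real.log (A * Real.exp (b * (l₀ * Real.cosh Y)) / m)) :
    ‖deriv f 0‖ ≤ Real.exp 1 * m * Real.log (A * Real.exp (b * (l₀ * Real.cosh Y)) / m) / (l₀ * Y) := by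
  have hA : 0 ≤ A := nonneg_of_growth hgrowth
  set M : ℝ := A * Real.exp (b * (l₀ * Real.cosh Y)) with hMdef
  set Λ : ℝ := Real.log (M / m) with hΛdef
  have hΛ0 : 0 < Λ := by linarith
  have hM0 : 0 ≤ M := mul_nonneg hA (Real.exp_pos _).le
  -- `M∕m ≥ e > 1` since its logarithm is `≥ 1`
  have hMm0 : 0 < M / m := by
    rcases (div_nonneg hM0 hm0.le).lt_or_eq with h | h
    · exact h
    · exfalso; rw [← h, Real.log_zero] at hΛdef; rw [hΛdef] at hΛ0; exact lt_irrefl _ hΛ0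
  have hMm : Real.exp 1 ≤ M / m := (Real.le_log_iff_exp_le hMm0).1 hΛ
  have hmM : m ≤ M := by
    have h1 : (1 : ℝ) ≤ M / m := le_trans (by linarith [Real.add_one_le_exp (1 : ℝ)]) hMm
    rwa [one_le_div hm0] at h1
  -- `y = Y∕Λ ≤ Y`
  have hy : 0 < Y / Λ := div_pos hY hΛ0
  have hyY : Y / Λ ≤ Y := div_le_self hY.le hΛ
  have key := norm_deriv_le_segment_threeLines hf hb hl₀ hgrowth hm hm0 hmM hy hyY
  -- `m^{1−1∕Λ}·M^{1∕Λ} = m·(M∕m)^{1∕Λ} = m·e`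
  have hτ : Y / Λ / Y = 1 / Λ := by field_simp
  have h1 : M = m * (M / m) := by field_simp
  have hval : m ^ (1 - Y / Λ / Y) * M ^ (Y / Λ / Y) = m * Real.exp 1 := by
    rw [hτ]
    conv_lhs => rw [h1]
    rw [Real.mul_rpow hm0.le hMm0.le, ← mul_assoc, ← Real.rpow_add hm0,
      show (1 - 1 / Λ) + 1 / Λ = 1 by ring, Real.rpow_one, Real.rpow_def_of_pos hMm0,
      show Real.log (M / m) * (1 / Λ) = 1 by rw [← hΛdef]; field_simp]
  rw [hval] at key
  refine key.trans (le_of_eq ?_)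
  field_simp

end Summit.QuantumFields.YangMills.Theorems.BalabanUVNodesN19SegmentThreeLines

end
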